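import Summits.HodgeConjecture.HodgeConjecture.Theses.CurveNetMordellWeil
import Literature.AlgebraicGeometry.HodgeTheory.SupportedHodgeClassesAlgebraic
import Literature.AlgebraicGeometry.HodgeTheory.TopDegreeClasses
import Literature.AlgebraicGeometry.Motives.SegreEmbedding
import Literature.AlgebraicGeometry.Motives.VarietiesProjectiveSpaceProofs
import Literature.AlgebraicGeometry.Motives.SubschemeCycles
import Literature.AlgebraicTopology.SingularHomology.GysinMapSupportProofs
import HarnessLib

/-!
# `AlgebraicInNormalForm` (route `CurveNetMordellWeil`, item stmt-HodgeConjecture-2790), from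
Deligne's Cor. 8.2.8 and projective Hironaka

The support item: on a smooth projective `2p`-fold `X` (`p ≥ 1`) every ALGEBRAIC class of
codimension `p` (`algebraicClasses X p = Nᵖ H²ᵖ(X(ℂ); ℂ)`) is a `ℂ`-combination of Gysin images
`f_* δ` of divisor classes `δ ∈ N¹ H²(W(ℂ); ℂ)` on smooth projective `(p+1)`-folds `f : W ⟶ X`.

Proof (the easy half of the card's "HC(p) ⇔ Mordell–Weil normal form", with the `(p+1)`-folds
taken to be `Ỹ × ℙ¹` rather than cones through `Z`): a class `c ∈ Nᵖ H²ᵖ` dies off ONE Zariski-closed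
`Z` of codimension `≥ p` (`exists_support_of_mem_supportedClasses`); `Z = ⋃ⱼ gⱼ(Yⱼ)` for finitely
many `gⱼ : Yⱼ ⟶ X` from smooth projective `Yⱼ` of dimensions `mⱼ ≤ 2p - p = p` (resolutions of the
components: the named fact `Resolution.Hironaka1964_projective`, through
`exists_family_iUnion_range_eq_of_isClosed`); by Deligne, *Hodge III*, Cor. 8.2.8 (the named fact
`Deligne1974_ker_restrictCompl_eq_iSup_range_complexGysin`) `c ∈ Σⱼ im ((gⱼ)_* : H^{2mⱼ-2p}(Yⱼ) → H²ᵖ(X))`,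
where only `mⱼ = p` (degree `0`) contributes. Finally, for `g : Y ⟶ X` with `dim Y = p` and
`y ∈ H⁰(Y(ℂ); ℂ)`: `W := Y × ℙ¹` is smooth projective of dimension `p + 1`, the slice
`s = (𝟙, t) : Y ⟶ Y × ℙ¹` at a complex point `t ∈ ℙ¹(ℂ)` has `s ≫ pr₁ = 𝟙`, so
`g_* y = (pr₁ ≫ g)_* (s_* y)` (`complexGysin_comp`, `complexGysin_id`), and `s_* y ∈ N¹ H²(W(ℂ))`
(`y ∈ N⁰ H⁰ = ⊤`, Gysin images of supported classes are supported on the image).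

The result is CONDITIONAL on the two named facts (both undischarged in the tree: Cor. 8.2.8 is
mixed Hodge theory, Hironaka is Hironaka); everything else is proved.

## References

* [DeligneHodgeIII1974] P. Deligne, Théorie de Hodge III, Publ. Math. IHÉS 44 (1974), Cor. 8.2.8.
* [Kollar2007] J. Kollár, Lectures on Resolution of Singularities, Thm. 3.27. [Hironaka1964]
* [Fulton1998] W. Fulton, Intersection Theory, 2nd ed. (1998), §19.1 (cycle classes and proper
  push-forward). [VoisinHodgeII2003] C. Voisin, Hodge Theory and Complex Algebraic Geometry II,
  Prop. 9.21.
* [FultonYoungTableaux1997] W. Fulton, Young Tableaux, App. B §B.1 (2), (5), §B.2 Exercise 5.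
-/

noncomputable section

set_option linter.dupNamespace false

open CategoryTheory AlgebraicGeometry MonoidalCategory CartesianMonoidalCategory
open Literature.AlgebraicTopology.SingularHomology
open Literature.AlgebraicGeometry Literature.AlgebraicGeometry.HodgeTheory

namespace Summit.HodgeConjecture.HodgeConjecture.Theorems

/-- **One resolution, degree `0`: the `ℙ¹`-trick.** For `g : Y ⟶ X` from a smooth projective
`p`-fold to a smooth projective `2p`-fold and `y ∈ H⁰(Y(ℂ); ℂ)`, the Gysin image `g_* y ∈ H²ᵖ(X(ℂ))`
is `f_* δ` for the smooth projective `(p+1)`-fold `W = Y × ℙ¹`, `f = pr₁ ≫ g`, and the divisor-supported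
class `δ = s_* y ∈ N¹ H²(W(ℂ))`, `s = (𝟙, t)` the slice at a complex point `t ∈ ℙ¹(ℂ)`
(`s ≫ pr₁ = 𝟙`, functoriality of Gysin maps; Gysin images of `N⁰ H⁰ = H⁰` land in `N¹ H²`).
[cite: FultonYoungTableaux1997, Appendix B §B.1 (2), (5) and §B.2 Exercise 5] -/
theorem complexGysin_mem_iSup_map_algebraicClasses_one (μ : OrientationFamily)
    (hμ : μ.HasPoincareDuality) {p m a : ℕ} {Y X : Motives.SchemeOver ℂ}
    (hX : Motives.IsSmoothProjective (2 * p) X) (hY : Motives.IsSmoothProjective m Y) (g : Y ⟶ X)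
    (hm : m = p) (hab : a + 2 * (2 * p) = 2 * p + 2 * m) (y : complexBetti Y a) :
    complexGysin μ hY hX g hab y ∈
      ⨆ (W : Motives.SchemeOver ℂ) (hW : Motives.IsSmoothProjective (p + 1) W) (f : W ⟶ X),
        (algebraicClasses W 1).map (complexGysin μ hW hX f
          (show 2 * 1 + 2 * (2 * p) = 2 * p + 2 * (p + 1) by omega)) := by
  subst hm
  obtain rfl : a = 0 := by omega
  -- the auxiliary factor `P = ℙ¹`, a complex point `t` of it, and the smooth projective `Y × P`
  have hP : Motives.IsSmoothProjective 1 (Motives.projectiveSpace 1 ℂ) :=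
    Motives.isSmoothProjective_projectiveSpace_holds ℂ 1
  haveI := connectedSpace_complexPoints hP
  obtain ⟨t⟩ : Nonempty (Motives.ComplexPoints (Motives.projectiveSpace 1 ℂ)) := inferInstance
  have hW : Motives.IsSmoothProjective (m + 1) (Y ⊗ Motives.projectiveSpace 1 ℂ) :=
    Motives.IsSmoothProjective.tensor_holds hY hP
  -- `δ = s_* y ∈ N¹ H²((Y × P)(ℂ))`
  have hy : y ∈ algebraicClasses Y 0 := by
    rw [algebraicClasses_zero]
    exact Submodule.mem_top
  have hδ : complexGysin μ hY hW (Motives.sliceAt Y t)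
      (show 2 * 0 + 2 * (m + 1) = 2 * 1 + 2 * m by omega) y ∈
        algebraicClasses (Y ⊗ Motives.projectiveSpace 1 ℂ) 1 :=
    complexGysin_mem_supportedClasses (gysinMap_restrictCompl_eq_zero_of_field ℂ) μ hμ hY hW
      (Motives.sliceAt Y t) _ (by omega) hy
  -- `pr₁_* ∘ s_* = (s ≫ pr₁)_* = 𝟙`
  have hsec : complexGysin μ hW hY (fst Y (Motives.projectiveSpace 1 ℂ))
        (show 2 * 1 + 2 * m = 2 * 0 + 2 * (m + 1) by omega) ∘ₗ
      complexGysin μ hY hW (Motives.sliceAt Y t)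
        (show 2 * 0 + 2 * (m + 1) = 2 * 1 + 2 * m by omega) = LinearMap.id := by
    rw [← complexGysin_comp hμ hY hW hY (Motives.sliceAt Y t) (fst Y (Motives.projectiveSpace 1 ℂ)),
      Motives.sliceAt_fst, complexGysin_id hμ hY]
  -- `g_* y = (pr₁ ≫ g)_* (s_* y)`
  have hcomp : complexGysin μ hW hX (fst Y (Motives.projectiveSpace 1 ℂ) ≫ g)
        (show 2 * 1 + 2 * (2 * m) = 2 * m + 2 * (m + 1) by omega)
      (complexGysin μ hY hW (Motives.sliceAt Y t)
        (show 2 * 0 + 2 * (m + 1) = 2 * 1 + 2 * m by omega) y) =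
      complexGysin μ hY hX g hab y := by
    rw [complexGysin_comp hμ hW hY hX (fst Y (Motives.projectiveSpace 1 ℂ)) g
        (show 2 * 1 + 2 * m = 2 * 0 + 2 * (m + 1) by omega) hab,
      LinearMap.comp_apply, ← LinearMap.comp_apply (complexGysin μ hW hY _ _), hsec,
      LinearMap.id_apply]
  rw [← hcomp]
  exact Submodule.mem_iSup_of_mem (Y ⊗ Motives.projectiveSpace 1 ℂ)
    (Submodule.mem_iSup_of_mem hW
      (Submodule.mem_iSup_of_mem (fst Y (Motives.projectiveSpace 1 ℂ) ≫ g)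
        (Submodule.mem_map_of_mem hδ)))

/-- **The slice `p = 1` of `AlgebraicInNormalForm`, unconditionally**: on a smooth projective
surface `X` every class of `N¹ H²(X(ℂ); ℂ)` is (trivially) a Gysin image of a divisor class from a
smooth projective `2`-fold, namely from `W = X` along `f = 𝟙 X` (`(𝟙 X)_* = 𝟙`). This is the
item's own remark "`p = 1`: `W = X`, `f = id`"; no resolution and no Hodge theory enter.
[cite: FultonYoungTableaux1997, Appendix B §B.1 (2) and (5)] -/
theorem algebraicInNormalForm_one (μ : OrientationFamily) (hμ : μ.HasPoincareDuality)
    {X : Motives.SchemeOver ℂ} (hX : Motives.IsSmoothProjective (2 * 1) X) :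
    algebraicClasses X 1 ≤
      ⨆ (W : Motives.SchemeOver ℂ) (hW : Motives.IsSmoothProjective (1 + 1) W) (f : W ⟶ X),
        (algebraicClasses W 1).map (complexGysin μ hW hX f
          (show 2 * 1 + 2 * (2 * 1) = 2 * 1 + 2 * (1 + 1) by omega)) := by
  intro c hc
  refine Submodule.mem_iSup_of_mem X (Submodule.mem_iSup_of_mem hX
    (Submodule.mem_iSup_of_mem (𝟙 X) ?_))
  rw [complexGysin_id hμ hX, Submodule.map_id]
  exact hc

/-- **`AlgebraicInNormalForm` from Deligne's Cor. 8.2.8 and projective Hironaka** (item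
stmt-HodgeConjecture-2790 of route `CurveNetMordellWeil`, CONDITIONAL on the two named facts
`Deligne1974_ker_restrictCompl_eq_iSup_range_complexGysin` and `Resolution.Hironaka1964_projective`):
on a smooth projective `2p`-fold `X`, `p ≥ 1`, every class of `Nᵖ H²ᵖ(X(ℂ); ℂ)` is a
`ℂ`-combination of Gysin images of classes of `N¹ H²(W(ℂ); ℂ)` from smooth projective
`(p+1)`-folds `f : W ⟶ X`. A class of `Nᵖ H²ᵖ` dies off one closed `Z` of codimension `≥ p`;
`Z = ⋃ⱼ gⱼ(Yⱼ)`, `Yⱼ` smooth projective of dimension `≤ p` (Hironaka); by Cor. 8.2.8 the class is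
a sum of `(gⱼ)_* yⱼ`, `yⱼ ∈ H^{2mⱼ - 2p}(Yⱼ(ℂ))`, forcing `mⱼ = p` and degree `0`; conclude by
`complexGysin_mem_iSup_map_algebraicClasses_one` (`W = Yⱼ × ℙ¹`). The slice `p = 1` is
`algebraicInNormalForm_one` (unconditional); the two facts are used for `p ≥ 2` only.
[cite: DeligneHodgeIII1974, Cor. 8.2.8] [cite: Kollar2007, Thm. 3.27]
[cite: Fulton1998, §19.1] [cite: VoisinHodgeII2003, §9.2.4 Prop. 9.21] -/
theorem algebraicInNormalForm_of_deligne_of_hironaka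
    (hD : Deligne1974_ker_restrictCompl_eq_iSup_range_complexGysin)
    (hH : Resolution.Hironaka1964_projective.{0}) :
    Summit.HodgeConjecture.HodgeConjecture.Theses.CurveNetMordellWeil.AlgebraicInNormalForm := by
  intro μ hμ p X hX _hp
  -- `p = 1` needs nothing (`W = X`, `f = 𝟙`); the facts enter for `p ≥ 2` only
  by_cases hp1 : p = 1
  · subst hp1
    exact algebraicInNormalForm_one μ hμ hX
  intro c hc
  -- one closed support of codimension `≥ p`
  obtain ⟨Z, hZ, hZp, hcZ⟩ := exists_support_of_mem_supportedClasses hc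
  -- resolve its components: `Z = ⋃ⱼ gⱼ(Yⱼ)`, `dim Yⱼ + p ≤ 2p`
  obtain ⟨ι, hι, m, Y, hY, g, hZeq, hm⟩ := exists_family_iUnion_range_eq_of_isClosed hH hX hZ hZp
  haveI := hι
  subst hZeq
  -- Deligne: `c ∈ Σⱼ im (gⱼ)_*`
  have hmem := Deligne1974_ker_restrictCompl_eq_iSup_range_complexGysin.mem_iSup_range hD μ hμ hX
    hY g hcZ
  refine SetLike.le_def.mp (iSup_le fun j ↦ iSup_le fun a ↦ iSup_le fun hab ↦ ?_) hmem
  rintro _ ⟨y, rfl⟩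
  have hmj : m j = p := by have := hm j; omega
  exact complexGysin_mem_iSup_map_algebraicClasses_one μ hμ hX (hY j) (g j) hmj hab y

end Summit.HodgeConjecture.HodgeConjecture.Theorems

end
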